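import Literature.MathematicalPhysics.QuantumFieldTheory.Balaban1983to89.B5Eq172HodgePositivity
import Literature.MathematicalPhysics.QuantumFieldTheory.Balaban1983to89.B5Eq172PoincareTorus
import Literature.MathematicalPhysics.QuantumFieldTheory.Balaban1983to89.B5Eq155FlatAveragingCommute
import Literature.MathematicalPhysics.QuantumFieldTheory.Balaban1983to89.B5Eq157AveragedConstants

/-!
# `Balaban1983to89.B5Eq172FlatCoercivity` — T. Bałaban, *Propagators and renormalization transformations for lattice gauge theories. I*,
# Commun. Math. Phys. **95** (1984) 17–40 [Balaban1984PropagatorsI] ("B5") p. 30 after (1.72) («so A = 0 and the positivity of Δ_a follows»),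
# — the one-step torus prototype of the flat positivity that [Balaban1985BackgroundPropagators] Thm 3.11 p. 416 invokes («In [4] we have proved
# that the operator G_□(1) is positive», ref. [4] there = *Propagators … II* [Balaban1984PropagatorsII]): THE COERCIVITY OF THE
# pub-balaban NE9 CHAIN'S PRINCIPAL GAUGE-FIXED OPERATOR `D*D + DR(1)D* + aQ(1)*Q(1)` AT THE FLAT BACKGROUND — the Hodge package of
# `B5Eq172HodgePositivity` FULLY DISCHARGED ((H1)/(H4) `B5Eq172PoincareTorus`, (H2) = (1.55) `B5Eq155FlatAveragingCommute` (NE9 leaf-01), (H3)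
# `B5Eq157AveragedConstants` (NE9 leaf-02), (H5) here): NO displayed
# hypothesis left besides `η ≠ 0`, `a > 0` and the chain's flat background data

statement-level skeleton of published theorems with citation tags; proofs where landed; nothing here is a claim about the Yang–Mills mass gap

PDF held: `paper:balaban1984-cmp95-propagators-rt-i` pp. 22, 27, 30; `paper:balaban1985-cmp99-background-propagators` pp. 393–395, 416; [B7] p. 27 via `B9Eq319QprimeTorus`.

THE PRINT (verbatim).  [B5] p. 30: *«Using (1.55) we have QA = ∂₁Q′Δ⁻²Q′*(Q′Δ⁻²Q′*)⁻¹ω + A₀ = ∂₁ω + A₀ = 0 … A₀ = 0, so A = 0 and the positivity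
of Δ_a follows.»*  p. 27: *«(1.55) Q_k∂ = ∂₁Q′_k»*, *«we can identify Q_kA₀ = B₀»*.  p. 22: *«Q′_k transforms constant functions on the η-lattice into
constant functions on the unit lattice»*.  [B7] p. 27 (`B9Eq319QprimeTorus.Qprime_flat`): *«(Q′λ)(y) = Σ_{x∈B(y)} L^{−d}λ(x)»*.

WHY THIS FILE (cell context).  JUNCTION of the NE9 owner's gen-79 `B5Eq172HodgePositivity.exists_coercive_principal_flat_of_hodge` (the displayed
`hγ` of `Support/NE9CurChartOfBackground.cur_chart_exists_of_principal_coercive` at `U := 1` from the Hodge package (H1)–(H5)) with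
`B5Eq172PoincareTorus` ((H1), (H4)), NE9 leaf-01 g72's `B5Eq155FlatAveragingCommute` ((H2) = (1.55), on the owner's OFFER O-ne9p1-g79-1),
`Qprime_flat` + `|B(y)| = L^d` ((H5)) and NE9 leaf-02 g51's `B5Eq157AveragedConstants` ((H3) «Q_kA₀ = B₀» for the one-step vector averaging
`Q(1)` = `B9Eq315QTorus.QtorusW … (fun _ ↦ 1) …`, on the same OFFER).  NOTHING of the Hodge package remains displayed.

WHAT IS PROVED (sorry-free; no `Prop` placeholder; no inequality of the papers).
* §1 `card_blockOf` (`|B(y)| = L^d` on the periodic lattice, by the bijection `x ↦ (x_i mod L)_i` with `Fin d → Fin L`); **`QprimeW_one_const`**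
  (p. 22: `Q′(1)` of the constant site function `v` is the constant coarse function `v`).
* §2 the coarse unit-lattice differentiation `∂₁` READ as `covDerivL2K c′ id ∘ (functions ↪ SiteL2K)` and (H4)/(H5) for it:
  `inner_dC_const` (`⟨∂₁ω, h′⟩ = 0` for constant `h′`), `exists_lift_of_dC_eq_zero` (`∂₁ω = 0 ⇒ ω = Q′(1)κ`, `κ` a fine constant, `Dκ = 0`).
* §4 **`laplaceAofBackground_one_pos`**: [B9] Thm 3.11 AT `U = 1` for the chain's assembled `Δ_a(1)` with no operator data (`B9Eq315QTorus.
  laplaceAofBackground … (fun _ ↦ 1) …`): `0 < re⟨x, Δ_a(1)x⟩` for `x ≠ 0` — the displayed `hpos` of `cur_chart_exists_of_W(_H126)` at the flat background,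
  PROVED (`hessOp_one`: `Δ′(1) = 0`, + §3).
* §5 CLOSED forms `exists_coercive_principal_flat₀` / `laplaceAofBackground_one_pos₀`: the flat background-data letters SUPPLIED (`α := 0`:
  `hU1_one` = `B7Eq122LinearPartIsLinear.one_mem_U1`, `hreg_one` = `flat_regular`) — only `η ≠ 0`, `a > 0` remain (reader ne9-leaf-04 g67 INFO-1).
* §6 `exists_coercive_principal_of_near_flat`: the SHAPE of [B9] Thm 3.11's second half at a fixed lattice — a flat `γ₀ > 0` such that the
  chain's `hγ` holds with `γ₀ − δ` at every background `U` whose assembled principal operator is `δ`-close (`δ < γ₀`) to the flat one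
  (`B5Eq172HodgePositivity.coercive_of_sub_le`); the closeness is DISPLAYED (print: (3.35)–(3.37) via (3.86)).
* §3 **`exists_coercive_principal_flat`**: for `η ≠ 0`, `a > 0` THERE IS `γ > 0` with
  `γ‖x‖² ≤ re⟨x, laplaceALatticeK η⁻¹ (R(1)) (R(1)⁻¹) (principalOpK φ η 1) (RofU L m φ η 1) (QtorusW L m hL φ 1 …) a x⟩` for all `x` — (H2) supplied by
  `B5Eq155FlatAveragingCommute.QtorusW_one_comp_covDerivL2K` (NE9 leaf-01) with the coarse scalar `c′ = (Lη)⁻¹`.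
MODEL / DECLARED READINGS.  (M1) as `B5Eq172HodgePositivity` §5 / `B9Eq315QTorus`; coarse weight `c₁` free.  (M2) no displayed hypothesis of the papers
(`hU1`/`hreg` are the chain's background-data letters at `U = 1`, supplied in §5).  (M3) NOT HERE: uniformity of `γ` ([B5] (1.90), b05's
`B5DeltaA169`); the perturbation to `U ≠ 1` ([B9] (3.86)) beyond §6's shape.  HONEST SCOPE: composition + a counting lemma + one flat averaging
identity; `γ` a finite-lattice number; NOT summit progress (NE9 NOT PRINTED / NOT PROVED; spine 0/9).  NE9 owner lineage gen 79; NEW file.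
-/

noncomputable section

open scoped InnerProductSpace ComplexConjugate BigOperators

namespace Literature.MathematicalPhysics.QuantumFieldTheory.Balaban1983to89.B5Eq172FlatCoercivity

open B4Sect5Torus (TSite)
open B9SectCLatticeCarrier (Bond)
open B7Prop1Explicit (U1 Wcx boxVec)
open B9Eq311L2Pairing (WL2)
open B9Eq319QprimeTorus (fineP blockCoord Qprime_flat QprimeLin_apply)
open B11Eq103H1Complex (SiteL2K BondL2K covDerivL2K laplaceALatticeK)
open B9Eq310HessianOperator (adTransportW principalOpK covCurlL2K)
open B9Eq326OperatorAssembly (RofU QprimeW)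
open B9Eq315QTorus (perCfg cornerSite QtorusW)
open B5Eq172HodgePositivity (adTransportW_one conj_inv_ofReal exists_coercive_principal_flat_of_hodge)
open B5Eq155FlatAveragingCommute (QtorusW_one_comp_covDerivL2K)
open B5Eq157AveragedConstants (QtorusW_one_mapsTo_constRange QtorusW_one_constRange_eq_zero)
open B5Eq172PoincareTorus (constBond constBond_apply constBondL2K equiv_constBondL2K hodge_flat covDerivL2K_const inner_covDerivL2K_const
  const_of_covDeriv_eq_zero)

variable {d : ℕ} (L : ℕ) [NeZero L] (m : Fin d → ℕ)

/-! ## §1 `|B(y)| = L^d` and p. 22: `Q′(1)` of a constant is the constant -/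

/-- **`|B(y)| = L^d`**: the block `B(y) = {x : x_i div L = y_i}` of the periodic lattice `Π_i ℤ/(L·m_i)ℤ` is in bijection with `Fin d → Fin L`
via the offsets `x_i mod L`. [cite: Balaban1985Averaging, (2) p.17] -/
theorem card_blockOf (y : TSite d m) : (B9Eq319QprimeTorus.blockOf L m y).card = L ^ d := by
  have hL : 0 < L := Nat.pos_of_ne_zero (NeZero.ne L)
  let e : {x // x ∈ B9Eq319QprimeTorus.blockOf L m y} ≃ (Fin d → Fin L) :=
    { toFun := fun x i => ⟨((x.1 i : ℕ)) % L, Nat.mod_lt _ hL⟩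
      invFun := fun r => ⟨fun i => ⟨L * (y i : ℕ) + r i, by
          have h1 : (y i : ℕ) + 1 ≤ m i := (y i).isLt
          have h2 : (r i : ℕ) < L := (r i).isLt
          calc L * (y i : ℕ) + r i < L * (y i : ℕ) + L := by omega
            _ = L * ((y i : ℕ) + 1) := by ring
            _ ≤ L * m i := Nat.mul_le_mul_left L h1⟩, by
          rw [B9Eq319QprimeTorus.mem_blockOf_iff]
          funext i
          apply Fin.ext
          rw [B9Eq319QprimeTorus.blockCoord_apply_val]
          show (L * (y i : ℕ) + r i) / L = (y i : ℕ)
          rw [Nat.mul_add_div hL, Nat.div_eq_of_lt (r i).isLt, add_zero]⟩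
      left_inv := fun x => by
        apply Subtype.ext
        funext i
        apply Fin.ext
        have hx := (B9Eq319QprimeTorus.mem_blockOf_iff L m y x.1).1 x.2
        have hi : ((x.1 i : ℕ)) / L = (y i : ℕ) := by
          rw [← B9Eq319QprimeTorus.blockCoord_apply_val L m x.1 i, hx]
        show L * (y i : ℕ) + (x.1 i : ℕ) % L = (x.1 i : ℕ)
        rw [← hi, Nat.div_add_mod]
      right_inv := fun r => by
        funext i
        apply Fin.ext
        show (L * (y i : ℕ) + (r i : ℕ)) % L = (r i : ℕ)
        rw [Nat.mul_add_mod, Nat.mod_eq_of_lt (r i).isLt] }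
  rw [← Fintype.card_coe, Fintype.card_congr e, Fintype.card_fun, Fintype.card_fin, Fintype.card_fin]

section Averaging

variable {𝔸 : Type*} [Ring 𝔸] [Algebra ℂ 𝔸] {W : Type*} [NormedAddCommGroup W] [InnerProductSpace ℂ W] (φ : W ≃ₗ[ℂ] 𝔸) {c₀ : ℝ}

/-- **p. 22 «Q′_k transforms constant functions on the η-lattice into constant functions on the unit lattice», quantitatively at the flat
background: `Q′(1)` of the constant site function `v` IS the constant coarse function `v`** — `Qprime_flat` (the plain block mean
`L^{−d} Σ_{x∈B(y)}`) and `|B(y)| = L^d`. [cite: Balaban1984PropagatorsI, p.22; Balaban1985Averaging, p.27] -/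
theorem QprimeW_one_const (v : W) :
    QprimeW L m φ (fun _ : Bond d (fineP L m) => (1 : 𝔸ˣ)) (c₀ := c₀) ((WL2.equiv ℂ (fun _ : TSite d (fineP L m) => c₀) W).symm fun _ => v) =
      fun _ => v := by
  have hL0 : ((L : ℝ)) ^ d ≠ 0 := pow_ne_zero _ (Nat.cast_ne_zero.2 (NeZero.ne L))
  have hflat : (fun b : Bond d (fineP L m) => (adTransportW φ (fun _ : Bond d (fineP L m) => (1 : 𝔸ˣ)) b).restrictScalars ℝ) =
      fun _ => (LinearMap.id : W →ₗ[ℝ] W) := by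
    funext b
    rw [adTransportW_one]
    rfl
  funext y
  rw [QprimeW, LinearMap.comp_apply, QprimeLin_apply, hflat, Qprime_flat]
  simp only [LinearEquiv.coe_coe, WL2.linearEquiv_apply, Equiv.apply_symm_apply]
  rw [Finset.sum_const, card_blockOf, ← Nat.cast_smul_eq_nsmul ℝ, Nat.cast_pow, smul_smul, mul_inv_cancel₀ hL0, one_smul]

end Averaging

/-! ## §2 The coarse unit-lattice differentiation `∂₁` read into the weighted `L²` space, and (H4)/(H5) for it -/

section Coarse

variable {W : Type*} [NormedAddCommGroup W] [InnerProductSpace ℂ W] [FiniteDimensional ℂ W] {c₁ : ℝ} [Fact (0 < c₁)] {c' : ℝ}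

/-- **(H4) for the coarse `∂₁ := c′·d₀` read into `BondL2K c₁`: `⟨∂₁ω, h′⟩ = 0` for every constant coarse vector function `h′`** («ω … orthogonal to
constant functions», p. 27). [cite: Balaban1984PropagatorsI, p.27, (1.72) p.30] -/
theorem inner_dC_const (ω : TSite d m → W) (h' : BondL2K ℂ d m c₁ W) (hh' : h' ∈ LinearMap.range (constBondL2K m ℂ c₁)) :
    ⟪(covDerivL2K ℂ c₁ ((c' : ℂ)) (fun _ : Bond d m => (LinearMap.id : W →ₗ[ℂ] W)) ∘ₗ
        (WL2.linearEquiv ℂ ℂ (fun _ : TSite d m => c₁)).symm.toLinearMap) ω, h'⟫_ℂ = 0 :=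
  inner_covDerivL2K_const (Complex.conj_ofReal c') (fun _ => rfl) (fun _ => rfl) _ h' hh'

variable [∀ i, NeZero (m i)] [∀ i, NeZero (fineP L m i)] {𝔸 : Type*} [Ring 𝔸] [Algebra ℂ 𝔸] (φ : W ≃ₗ[ℂ] 𝔸) {c₀ : ℝ} [Fact (0 < c₀)] (η : ℝ)

omit [FiniteDimensional ℂ W] in
/-- **(H5) for the coarse `∂₁` (`c′ ≠ 0`): a coarse gauge parameter with `∂₁ω = 0` is a constant (p. 22, `const_of_covDeriv_eq_zero`), hence `Q′(1)`
of the constant fine function with the same value (`QprimeW_one_const`), whose flat gradient vanishes.** [cite: Balaban1984PropagatorsI, p.22, (1.72) p.30] -/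
theorem exists_lift_of_dC_eq_zero (hc' : c' ≠ 0) (ω : TSite d m → W)
    (hω : (covDerivL2K ℂ c₁ ((c' : ℂ)) (fun _ : Bond d m => (LinearMap.id : W →ₗ[ℂ] W)) ∘ₗ
        (WL2.linearEquiv ℂ ℂ (fun _ : TSite d m => c₁)).symm.toLinearMap) ω = 0) :
    ∃ κ : SiteL2K ℂ d (fineP L m) c₀ W,
      covDerivL2K ℂ c₀ ((η : ℂ))⁻¹ (adTransportW φ (fun _ : Bond d (fineP L m) => (1 : 𝔸ˣ))) κ = 0 ∧
        QprimeW L m φ (fun _ : Bond d (fineP L m) => (1 : 𝔸ˣ)) κ = ω := by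
  have hω' : B9Eq33CovDerivVector.covDeriv ((c' : ℂ)) (fun _ : Bond d m => (LinearMap.id : W →ₗ[ℂ] W)) ω = 0 := by
    have h := congrArg (WL2.equiv ℂ (fun _ : Bond d m => c₁) W) hω
    rw [LinearMap.comp_apply, B11Eq103H1Complex.equiv_covDerivL2K, WL2.equiv_zero] at h
    exact h
  have hconst : ω = fun _ => ω 0 :=
    funext fun y => const_of_covDeriv_eq_zero (Complex.ofReal_ne_zero.2 hc') (fun _ => rfl) hω' y
  refine ⟨(WL2.equiv ℂ (fun _ : TSite d (fineP L m) => c₀) W).symm fun _ => ω 0, covDerivL2K_const _ (adTransportW_one φ) _, ?_⟩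
  rw [QprimeW_one_const, ← hconst]

end Coarse


/-! ## §3 The flat coercivity of the NE9 chain's principal gauge-fixed operator -/

section Main

variable [∀ i, NeZero (fineP L m i)] (hL : 1 ≤ L)
  {𝔸 : Type*} [NormedRing 𝔸] [NormedAlgebra ℂ 𝔸] [CompleteSpace 𝔸] [NormOneClass 𝔸]
  {W : Type*} [NormedAddCommGroup W] [InnerProductSpace ℂ W] [FiniteDimensional ℂ W] (φ : W ≃ₗ[ℂ] 𝔸) {c₀ c₁ : ℝ} [Fact (0 < c₀)] [Fact (0 < c₁)]
  {η : ℝ} (hη : η ≠ 0) {α : ℝ} (hα1 : α ≤ 1 / 64)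
  (hU1 : ∀ (x : B7Prop1Explicit.Site d) (κ : Fin d), perCfg (fineP L m) (fun _ : Bond d (fineP L m) => (1 : 𝔸ˣ)) x κ ∈ U1 𝔸)
  (hreg : ∀ (y : TSite d m) (κ : Fin d) (r : Fin d → Fin L),
    ‖((Wcx L (perCfg (fineP L m) (fun _ : Bond d (fineP L m) => (1 : 𝔸ˣ))) (cornerSite L y) κ (boxVec L r) : 𝔸ˣ) : 𝔸) - 1‖ ≤ α)
  {a : ℝ} (ha : 0 < a)

include hη ha

/-- **THE FLAT COERCIVITY OF THE NE9 CHAIN'S PRINCIPAL GAUGE-FIXED OPERATOR** — [B5] p. 30 «the positivity of Δ_a follows» (the one-step torus prototype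
of [B9] p. 416's «G_□(1) is positive», ref. [4] there = [Balaban1984PropagatorsII]) at the chain's letters: for `η ≠ 0`, `a > 0` there is `γ > 0` with
`γ‖x‖² ≤ re⟨x, laplaceALatticeK η⁻¹ R(1) R(1)⁻¹ (principalOpK φ η 1) (RofU L m φ η 1) (QtorusW L m hL φ 1 …) a x⟩` — the `hγ` of
`Support/NE9CurChartOfBackground.cur_chart_exists_of_principal_coercive` at `U := 1` — with EVERY member of the Hodge package PROVED: (H0)
`⟨x,D*Dx⟩ = ‖Dx‖²` (`B5Eq172HodgePositivity` §5), (H1) Poincaré and (H4) `∂₁ω ⊥` constants (`B5Eq172PoincareTorus`), (H2) (1.55) `Q(1) ∘ D = ∂₁ ∘ Q′(1)`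
with `∂₁ := (Lη)⁻¹·d₀` on the coarse torus (`B5Eq155FlatAveragingCommute`, NE9 leaf-01 gen 72), (H3) «Q(1)A₀ = A₀» (`B5Eq157AveragedConstants`, NE9
leaf-02 gen 51), (H5) `∂₁ω = 0 ⇒ ω = Q′(1)κ` (§§1–2; the averaging half independently staged by NE9 leaf-03 gen 56 as `B9Eq319QprimeFlatConst`
and yielded).
The constant `γ` is a finite-lattice number (uniformity = [B5] (1.90), not here).
[cite: Balaban1984PropagatorsI, (1.72) p.30, (1.55) p.27; Balaban1985BackgroundPropagators, (3.26) p.395, Thm 3.11 p.416] -/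
theorem exists_coercive_principal_flat :
    ∃ γ : ℝ, 0 < γ ∧ ∀ x : BondL2K ℂ d (fineP L m) c₀ W, γ * ‖x‖ ^ 2 ≤
      RCLike.re ⟪x, laplaceALatticeK ((η : ℂ))⁻¹ (adTransportW φ (fun _ : Bond d (fineP L m) => (1 : 𝔸ˣ)))
        (adTransportW φ fun _ : Bond d (fineP L m) => (1 : 𝔸ˣ)⁻¹) (principalOpK φ η fun _ => 1) (RofU L m φ η fun _ => 1)
        (QtorusW L m hL φ (fun _ => 1) hα1 hU1 hreg (c₁ := c₁)) a x⟫_ℂ :=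
  -- `L·m_i ≠ 0 ⇒ m_i ≠ 0` (reader ne9-leaf-04 g67, INFO-2)
  haveI : ∀ i, NeZero (m i) := fun i => ⟨right_ne_zero_of_mul (NeZero.ne (fineP L m i))⟩
  have hc : ((η : ℂ))⁻¹ ≠ 0 := inv_ne_zero (Complex.ofReal_ne_zero.2 hη)
  have hc' : (((L : ℝ)) * η)⁻¹ ≠ 0 := inv_ne_zero (mul_ne_zero (Nat.cast_ne_zero.2 (NeZero.ne L)) hη)
  exists_coercive_principal_flat_of_hodge φ η L m hL hα1 hU1 hreg a
    (fun x hx => hodge_flat hc (adTransportW_one φ) x hx) (QtorusW_one_comp_covDerivL2K L m hL φ hα1 hU1 hreg η)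
    (QtorusW_one_mapsTo_constRange L m hL hα1 hU1 hreg φ) (QtorusW_one_constRange_eq_zero L m hL hα1 hU1 hreg φ)
    (fun ω h' hh' => inner_dC_const m ω h' hh')
    (fun ω hω => exists_lift_of_dC_eq_zero L m φ η hc' ω hω) ha

end Main

/-! ## §4 [B9] Thm 3.11 at `U = 1` for the chain's assembled `Δ_a(1)`: the displayed `hpos` of the NE9 letters PROVED at the flat background -/

section Hpos

open B9Eq315QTorus (laplaceAofBackground laplaceAofBackground_eq)
open B9Eq326OperatorAssembly (laplaceAofU_eq)
open B9Eq310HessianOperator (hessOp_one)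

variable [∀ i, NeZero (fineP L m i)] (hL : 1 ≤ L)
  {𝔸 : Type*} [NormedRing 𝔸] [NormedAlgebra ℂ 𝔸] [CompleteSpace 𝔸] [NormOneClass 𝔸] [StarRing 𝔸] [StarModule ℂ 𝔸]
  {W : Type*} [NormedAddCommGroup W] [InnerProductSpace ℂ W] [FiniteDimensional ℂ W] (φ : W ≃ₗ[ℂ] 𝔸) {c₀ c₁ : ℝ} [Fact (0 < c₀)] [Fact (0 < c₁)]
  (τ : 𝔸 →ₗ[ℂ] ℂ) {η : ℝ} (hη : η ≠ 0) {α : ℝ} (hα1 : α ≤ 1 / 64)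
  (hU1 : ∀ (x : B7Prop1Explicit.Site d) (κ : Fin d), perCfg (fineP L m) (fun _ : Bond d (fineP L m) => (1 : 𝔸ˣ)) x κ ∈ U1 𝔸)
  (hreg : ∀ (y : TSite d m) (κ : Fin d) (r : Fin d → Fin L),
    ‖((Wcx L (perCfg (fineP L m) (fun _ : Bond d (fineP L m) => (1 : 𝔸ˣ))) (cornerSite L y) κ (boxVec L r) : 𝔸ˣ) : 𝔸) - 1‖ ≤ α)
  {a : ℝ} (ha : 0 < a)

include hη ha

/-- **[B9] Thm 3.11 «Δ_a is positive definite» AT THE FLAT BACKGROUND, for the chain's assembled operator with NO operator data** — the displayed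
`hpos` of `B9Eq315QTorus`/`B9Eq315QTorusOnto`/`Support/NE9CurChartOfBackground.cur_chart_exists_of_W(_H126)` at `U := 1` IS A THEOREM:
`0 < re⟨x, laplaceAofBackground L m hL φ 1 hα1 hU1 hreg τ η a x⟩` for `x ≠ 0` (`η ≠ 0`, `a > 0`).  At `U = 1` the Hessian (3.10) is its principal part
(`hessOp_one`: `Δ′(1) = 0`), so this is §3's coercivity. [cite: Balaban1985BackgroundPropagators, Thm 3.11 p.416, (3.26) p.395; Balaban1984PropagatorsI, (1.72) p.30] -/
theorem laplaceAofBackground_one_pos (x : BondL2K ℂ d (fineP L m) c₀ W) (hx : x ≠ 0) :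
    0 < RCLike.re (inner ℂ x (laplaceAofBackground L m hL φ (fun _ : Bond d (fineP L m) => (1 : 𝔸ˣ)) hα1 hU1 hreg τ η (c₀ := c₀) (c₁ := c₁) a x)) := by
  obtain ⟨γ, hγ0, hγ⟩ := exists_coercive_principal_flat L m hL φ (c₀ := c₀) (c₁ := c₁) hη hα1 hU1 hreg ha
  have hx2 : 0 < γ * ‖x‖ ^ 2 := mul_pos hγ0 (by positivity)
  have h := hγ x
  rw [laplaceAofBackground_eq, laplaceAofU_eq, hessOp_one]
  exact lt_of_lt_of_le hx2 h

end Hpos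

/-! ## §5 CLOSED FORMS: the flat background-data letters inhabited (`α = 0`: `1 ∈ U1`, `W_{c,x}(1) = 1`) -/

section Closed

open B9Eq315QTorus (laplaceAofBackground)
open B7Eq122LinearPartIsLinear (one_mem_U1 flat_regular)

variable [∀ i, NeZero (fineP L m i)] (hL : 1 ≤ L)
  {𝔸 : Type*} [NormedRing 𝔸] [NormedAlgebra ℂ 𝔸] [CompleteSpace 𝔸] [NormOneClass 𝔸]
  {W : Type*} [NormedAddCommGroup W] [InnerProductSpace ℂ W] [FiniteDimensional ℂ W] (φ : W ≃ₗ[ℂ] 𝔸) {c₀ c₁ : ℝ} [Fact (0 < c₀)] [Fact (0 < c₁)]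
  {η : ℝ} (hη : η ≠ 0) {a : ℝ} (ha : 0 < a)

omit [NeZero L] [NormedAlgebra ℂ 𝔸] [CompleteSpace 𝔸] in
/-- At the flat background the periodic extension is the unit-bounded configuration `1` (the `hU1` letter, inhabited).
[cite: Balaban1985Averaging, (124)–(125) p.36] -/
theorem hU1_one (x : B7Prop1Explicit.Site d) (κ : Fin d) : perCfg (fineP L m) (fun _ : Bond d (fineP L m) => (1 : 𝔸ˣ)) x κ ∈ U1 𝔸 :=
  one_mem_U1 x κ

omit [NeZero L] [NormedAlgebra ℂ 𝔸] [CompleteSpace 𝔸] [NormOneClass 𝔸] in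
/-- At the flat background every block loop is `1` (the `hreg` letter, inhabited with `α = 0`). [cite: Balaban1985Averaging, (52) p.26, (124) p.36] -/
theorem hreg_one (y : TSite d m) (κ : Fin d) (r : Fin d → Fin L) :
    ‖((Wcx L (perCfg (fineP L m) (fun _ : Bond d (fineP L m) => (1 : 𝔸ˣ))) (cornerSite L y) κ (boxVec L r) : 𝔸ˣ) : 𝔸) - 1‖ ≤ 0 :=
  flat_regular (cornerSite L y) κ r

include hη ha

/-- **THE FLAT COERCIVITY, CLOSED** (`α := 0`, the two background-data letters supplied): only `η ≠ 0`, `a > 0` remain.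
[cite: Balaban1984PropagatorsI, (1.72) p.30; Balaban1985BackgroundPropagators, (3.26) p.395, Thm 3.11 p.416] -/
theorem exists_coercive_principal_flat₀ :
    ∃ γ : ℝ, 0 < γ ∧ ∀ x : BondL2K ℂ d (fineP L m) c₀ W, γ * ‖x‖ ^ 2 ≤
      RCLike.re ⟪x, laplaceALatticeK ((η : ℂ))⁻¹ (adTransportW φ (fun _ : Bond d (fineP L m) => (1 : 𝔸ˣ)))
        (adTransportW φ fun _ : Bond d (fineP L m) => (1 : 𝔸ˣ)⁻¹) (principalOpK φ η fun _ => 1) (RofU L m φ η fun _ => 1)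
        (QtorusW L m hL φ (fun _ => 1) (show (0 : ℝ) ≤ 1 / 64 by norm_num) (hU1_one L m) (hreg_one L m) (c₁ := c₁)) a x⟫_ℂ :=
  exists_coercive_principal_flat L m hL φ hη _ _ _ ha

variable [StarRing 𝔸] [StarModule ℂ 𝔸] (τ : 𝔸 →ₗ[ℂ] ℂ)

/-- **[B9] Thm 3.11 AT `U = 1`, CLOSED**: the chain's assembled `Δ_a(1)` (flat background-data letters supplied, `α := 0`) is positive definite for
`η ≠ 0`, `a > 0`. [cite: Balaban1985BackgroundPropagators, Thm 3.11 p.416, (3.26) p.395; Balaban1984PropagatorsI, (1.72) p.30] -/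
theorem laplaceAofBackground_one_pos₀ (x : BondL2K ℂ d (fineP L m) c₀ W) (hx : x ≠ 0) :
    0 < RCLike.re (inner ℂ x (laplaceAofBackground L m hL φ (fun _ : Bond d (fineP L m) => (1 : 𝔸ˣ)) (show (0 : ℝ) ≤ 1 / 64 by norm_num)
      (hU1_one L m) (hreg_one L m) τ η (c₀ := c₀) (c₁ := c₁) a x)) :=
  laplaceAofBackground_one_pos L m hL φ τ hη _ _ _ ha x hx

end Closed

/-! ## §6 The shape of [B9] Thm 3.11's SECOND half at a fixed lattice: coercivity at a background near the flat one -/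

section NearFlat

open B5Eq172HodgePositivity (coercive_of_sub_le)

variable [∀ i, NeZero (fineP L m i)] (hL : 1 ≤ L)
  {𝔸 : Type*} [NormedRing 𝔸] [NormedAlgebra ℂ 𝔸] [CompleteSpace 𝔸] [NormOneClass 𝔸]
  {W : Type*} [NormedAddCommGroup W] [InnerProductSpace ℂ W] [FiniteDimensional ℂ W] (φ : W ≃ₗ[ℂ] 𝔸) {c₀ c₁ : ℝ} [Fact (0 < c₀)] [Fact (0 < c₁)]
  {η : ℝ} (hη : η ≠ 0) {a : ℝ} (ha : 0 < a)

include hη ha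

/-- **THM 3.11's SECOND HALF AT A FIXED LATTICE, AS A SHAPE** (p. 416: `G_□(U) = G_□(1)(I − V(A)G_□(1))⁻¹` with `V(A)` small, (3.86)): there is a
flat constant `γ₀ > 0` (§5) such that for EVERY background `U` whose assembled principal gauge-fixed operator `D_U*D_U + D_U R(U) D_U* + aQ(U)*Q(U)`
is `δ`-close to the flat one in the sense `‖(Δ_prin(U) − Δ_prin(1))x‖ ≤ δ‖x‖` with `δ < γ₀`, the coercivity `hγ` of
`Support/NE9CurChartOfBackground.cur_chart_exists_of_principal_coercive` holds at `U` with `γ = γ₀ − δ`.  The closeness is the DISPLAYED input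
(print: from (3.35)–(3.37) via (3.86); at a fixed lattice: operator-norm continuity of `principalOpK`, `RofU`, `QtorusW` in `U`) — NOT proved here.
[cite: Balaban1985BackgroundPropagators, Thm 3.11 p.416, (3.86) p.407; Balaban1984PropagatorsI, (1.72) p.30] -/
theorem exists_coercive_principal_of_near_flat :
    ∃ γ₀ : ℝ, 0 < γ₀ ∧ ∀ (δ : ℝ) (U : Bond d (fineP L m) → 𝔸ˣ) {α : ℝ} (hα1 : α ≤ 1 / 64)
      (hU1 : ∀ (x : B7Prop1Explicit.Site d) (κ : Fin d), perCfg (fineP L m) U x κ ∈ U1 𝔸)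
      (hreg : ∀ (y : TSite d m) (κ : Fin d) (r : Fin d → Fin L), ‖((Wcx L (perCfg (fineP L m) U) (cornerSite L y) κ (boxVec L r) : 𝔸ˣ) : 𝔸) - 1‖ ≤ α),
      (∀ x : BondL2K ℂ d (fineP L m) c₀ W,
        ‖laplaceALatticeK ((η : ℂ))⁻¹ (adTransportW φ U) (adTransportW φ fun b => (U b)⁻¹) (principalOpK φ η U) (RofU L m φ η U)
            (QtorusW L m hL φ U hα1 hU1 hreg (c₁ := c₁)) a x -
          laplaceALatticeK ((η : ℂ))⁻¹ (adTransportW φ (fun _ : Bond d (fineP L m) => (1 : 𝔸ˣ)))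
            (adTransportW φ fun _ : Bond d (fineP L m) => (1 : 𝔸ˣ)⁻¹) (principalOpK φ η fun _ => 1) (RofU L m φ η fun _ => 1)
            (QtorusW L m hL φ (fun _ => 1) (show (0 : ℝ) ≤ 1 / 64 by norm_num) (hU1_one L m) (hreg_one L m) (c₁ := c₁)) a x‖ ≤ δ * ‖x‖) →
      ∀ x : BondL2K ℂ d (fineP L m) c₀ W, (γ₀ - δ) * ‖x‖ ^ 2 ≤
        RCLike.re ⟪x, laplaceALatticeK ((η : ℂ))⁻¹ (adTransportW φ U) (adTransportW φ fun b => (U b)⁻¹) (principalOpK φ η U) (RofU L m φ η U)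
          (QtorusW L m hL φ U hα1 hU1 hreg (c₁ := c₁)) a x⟫_ℂ := by
  obtain ⟨γ₀, hγ₀, hflat⟩ := exists_coercive_principal_flat₀ L m hL φ (c₀ := c₀) (c₁ := c₁) hη ha
  exact ⟨γ₀, hγ₀, fun δ U α hα1 hU1 hreg hnear x => coercive_of_sub_le hflat hnear x⟩

end NearFlat

end Literature.MathematicalPhysics.QuantumFieldTheory.Balaban1983to89.B5Eq172FlatCoercivity

end
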